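import Literature.AlgebraicGeometry.Resolution.HironakaGroupSchemeAdditiveGenerators
import Literature.RingTheory.MvPolynomial.StandardBaseExists
import Literature.RingTheory.HilbertSamuel.TangentConeIdeal
import Literature.RingTheory.HilbertSamuel.NormalConeFibreIdeal
import Mathlib.Algebra.MvPolynomial.Rename
import HarnessLib

/-!
# Hironaka 1970 (Kyoto), (14.3): a cone is invariant under `B_{g,x'}` iff its ideal has a
# standard base consisting of elements of `U_{g,x'}` — the graded algebra of §14, p. 170

Topic: `Literature/AlgebraicGeometry/Resolution`, sub-namespace `HironakaScheme` (the namespace of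
`HironakaGroupSchemeMultiplicity.lean`, which defines `multAlgebra k 𝔭 = U(𝔭)`).

Source: H. Hironaka, *Certain numerical characters of singularities*, J. Math. Kyoto Univ. 10 (1970)
151–187 [`Hironaka1970NumericalCharacters`], held text
`paper:hironaka1970-certain-numerical-characters-singularities` (PDF page `k` = printed p. `150 + k`;
OCR). Read on the page:

> (Remark 1, p. 155 L16–20) «A system of generators `φ = (φ_1, …, φ_m)` of a homogeneous ideal `I`
> in a graded algebra is called a standard base of `I`, if (i) `φ` is a minimal base of `I`, (ii) each
> `φ_i` is homogeneous for every `i`, and (iii) `deg φ_1 ≤ deg φ_2 ≤ ⋯ ≤ deg φ_m`.»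
> (p. 168 L22–31, (13.1)) «`gr_x(Z) = K[X_0, …, X_r, Y_1, …, Y_s]` and `gr_x(Z,D) = K[X_0, …, X_r]`.
> `U_{g,x'}` is then the graded `K`-subalgebra of the polynomial ring `K[X]` whose homogeneous part
> of degree `d` is `{φ ∈ K[X]_d | ν_{x'}(φ/X_0^d) ≥ d}`.»
> (p. 169 L33 – p. 170 L9) «Let `I` be the homogeneous ideal of the cone `C_{X,D,x}` in `K[X]` […].
> By definition, `C_{X,x}` is invariant by `B_{g,x'}` if and only if the ideal of `C_{X,x}` in
> `gr_x(Z)` is generated by elements of `U_{g,x'}`. By the normal flatness assumption (2.1), the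
> ideal of `C_{X,x}` in `gr_x(Z)` is generated by the ideal of `C_{X,D,x}` in `gr_x(Z,D) = K[X]`. It
> follows that (14.3) `C_{X,x}` is invariant by `B_{g,x'}` if and only if there exists a standard
> base of the ideal `I` consisting of elements in `U_{g,x'}`.»

## What is proved (pure graded algebra; no scheme, no group scheme)

For a field `K`, `S = K[X_1, …, X_n]` (`MvPolynomial (Fin n) K`), a homogeneous ideal `I ⊆ S`
(`IsHomogeneousIdeal`, `HilbertFunctionsNoetherian.lean`) and a set `G ⊆ S` CLOSED UNDER HOMOGENEOUS
COMPONENTS — e.g. the carrier of a graded subalgebra (`IsGradedSubalgebra`,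
`HasseSchmidtCoefficients.lean`), in particular of Hironaka's `U(𝔭) = multAlgebra K 𝔭`
(`isGradedSubalgebra_multAlgebra`):

* §1 `le_span_inter_iff_exists_isStandardBase` — **`I` is generated by elements of `G`
  (`I ≤ span (I ∩ G)`) iff `I` has a standard base (CJS Def. 2.3, `IsStandardBase` of
  `NuInvariant.lean`) all of whose members lie in `G`**. The non-trivial direction refines the
  existence proof of `StandardBaseExists.lean`: a degree-sorted family of homogeneous generators
  TAKEN FROM `G` of minimal length is weakly normalized (omission argument, CJS Rem. 2.5); homogeneous
  generators inside `G` exist because both `I` and `G` are closed under homogeneous components.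
* §2 `isStandardBase_iff_minimal` — CJS's standard bases (weakly normalized: `φ_j ∉ ⟨φ_l : l < j⟩`)
  ARE Hironaka's standard bases of Remark 1 (minimal: `φ_j ∉ ⟨φ_l : l ≠ j⟩`) — by the graded Nakayama
  lemma `IsStandardBase.eq_zero_of_sum_C_mul_mem`.
* §3 `map_le_span_inter_image_iff` — the normal-flatness clause of p. 170 L5–9 as algebra: along a
  ring map with a retraction (e.g. `K[X] ⊆ K[X, Y] = gr_x(Z)`, `rename` of an injective map of
  variables, retraction `killCompl`), **`I·K[X,Y]` is generated by elements of `U ⊆ K[X]` iff `I` is**.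
* §4 the assembled (14.3) over `HironakaScheme.multAlgebra`, in the two shapes the cell's typed facts
  use: `tangentConeIdeal_le_span_inter_multAlgebra_iff` (point centre — the conclusion of
  `Hironaka1970_thmIV_point`, `Hironaka1970NearPointInvariantCone.lean`, is literally the left side)
  and `normalConeIdeal_le_span_inter_multAlgebra_iff` (arbitrary centre — the conclusion of
  `Hironaka1970_thmIV`, `Hironaka1970NearPointNormalCone.lean`), plus the `gr_x(Z)`-form
  `map_rename_le_span_inter_multAlgebra_iff`.

This is STAGE S1 of the cell res-hironaka reading of [H4] Th. IV (director-resolution 2026-08-27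
12:04:18Z: «the (14.3) equivalence over `multAlgebra`, pure graded algebra, independently bankable»);
it does NOT prove Th. IV (Lemmas 14–20 of [H4] are not touched) and asserts nothing about any
manuscript under review. AI-written; AI review is weaker than expert review.

## References

* H. Hironaka, J. Math. Kyoto Univ. 10 (1970) 151–187: Remark 1 p. 155, (13.1)–(13.2) p. 168,
  (14.3) p. 170 L3–9. [Hironaka1970NumericalCharacters]
* V. Cossart, U. Jannsen, S. Saito, *Desingularization: Invariants and Strategy*, LNM 2270 (2020),
  Def. 2.3, Rem. 2.5, Lemma 2.2 (proof). [CossartJannsenSaito2020]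
-/

noncomputable section

open MvPolynomial
open Literature.RingTheory.MvPolynomial Literature.RingTheory.HilbertSamuel

namespace Literature.AlgebraicGeometry.Resolution.HironakaScheme

universe u v w

/-! ## 1. Standard bases inside a set closed under homogeneous components -/

section Within

variable {K : Type u} [Field K] {n : ℕ} {G : Set (MvPolynomial (Fin n) K)}
  {I : Ideal (MvPolynomial (Fin n) K)}

/-- If `I` is generated by its elements lying in `G` then `span (I ∩ G) = I` («generated by elements of
`U`», p. 170 L3–4). [cite: Hironaka1970NumericalCharacters, p. 170 L3–4] -/
theorem span_inter_eq_of_le (hIG : I ≤ Ideal.span ((I : Set (MvPolynomial (Fin n) K)) ∩ G)) :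
    Ideal.span ((I : Set (MvPolynomial (Fin n) K)) ∩ G) = I :=
  le_antisymm (Ideal.span_le.mpr Set.inter_subset_left) hIG

/-- «`I` is generated by elements of `G`» ([H4] p. 170 L3–4) in two equivalent spellings: `I` is the
span of some subset of `G`, iff `I ≤ span (I ∩ G)`. [cite: Hironaka1970NumericalCharacters, p. 170 L3–4] -/
theorem le_span_inter_iff_exists_subset_span_eq :
    I ≤ Ideal.span ((I : Set (MvPolynomial (Fin n) K)) ∩ G) ↔
      ∃ T : Set (MvPolynomial (Fin n) K), T ⊆ G ∧ Ideal.span T = I := by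
  constructor
  · exact fun h => ⟨_, Set.inter_subset_right, span_inter_eq_of_le h⟩
  · rintro ⟨T, hTG, rfl⟩
    exact Ideal.span_mono fun t ht => ⟨Ideal.subset_span ht, hTG ht⟩

/-- A family generating `I` with all members in `G` exhibits `I ≤ span (I ∩ G)` (the trivial half of
(14.3)). [cite: Hironaka1970NumericalCharacters, (14.3) p. 170 L3–9] -/
theorem le_span_inter_of_span_range_eq {ι : Type w} {φ : ι → MvPolynomial (Fin n) K}
    (hspan : Ideal.span (Set.range φ) = I) (hφ : ∀ j, φ j ∈ G) :
    I ≤ Ideal.span ((I : Set (MvPolynomial (Fin n) K)) ∩ G) := by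
  rw [← hspan]
  refine Ideal.span_mono ?_
  rintro _ ⟨j, rfl⟩
  exact ⟨Ideal.subset_span ⟨j, rfl⟩, hφ j⟩

/-- **Homogeneous generators inside `G`.** If `G` is closed under homogeneous components, `I` is a
homogeneous ideal and `I` is generated by elements of `G`, then `I` is generated by a FINITE set of
HOMOGENEOUS elements of `G` (finitely many generators from `I ∩ G` by noetherianity, then their
homogeneous components). [cite: CossartJannsenSaito2020, Rem. 2.5] -/
theorem exists_finset_homogeneous_subset_span_eq
    (hG : ∀ g ∈ G, ∀ d : ℕ, homogeneousComponent d g ∈ G) (hI : IsHomogeneousIdeal I)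
    (hIG : I ≤ Ideal.span ((I : Set (MvPolynomial (Fin n) K)) ∩ G)) :
    ∃ t : Finset (MvPolynomial (Fin n) K), (∀ g ∈ t, g.IsHomogeneous g.totalDegree) ∧
      (↑t ⊆ G) ∧ Ideal.span (t : Set (MvPolynomial (Fin n) K)) = I := by
  classical
  have hfg : (Submodule.span (MvPolynomial (Fin n) K)
      ((I : Set (MvPolynomial (Fin n) K)) ∩ G)).FG := by
    change (Ideal.span ((I : Set (MvPolynomial (Fin n) K)) ∩ G)).FG
    rw [span_inter_eq_of_le hIG]
    exact IsNoetherian.noetherian I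
  obtain ⟨s, hs, hspan⟩ := (Submodule.fg_span_iff_fg_span_finset_subset _).mp hfg
  have hspanI : Ideal.span (s : Set (MvPolynomial (Fin n) K)) = I := by
    change Submodule.span (MvPolynomial (Fin n) K) (s : Set (MvPolynomial (Fin n) K)) = I
    rw [← hspan]
    exact span_inter_eq_of_le hIG
  refine ⟨s.biUnion fun g => (Finset.range (g.totalDegree + 1)).image fun i => homogeneousComponent i g,
    ?_, ?_, le_antisymm (Ideal.span_le.mpr ?_) ?_⟩
  · intro h hh
    obtain ⟨g, -, hg⟩ := Finset.mem_biUnion.mp hh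
    obtain ⟨i, -, rfl⟩ := Finset.mem_image.mp hg
    by_cases h0 : homogeneousComponent i g = 0
    · rw [h0]
      exact isHomogeneous_zero _ _ _
    · rw [(homogeneousComponent_isHomogeneous i g).totalDegree h0]
      exact homogeneousComponent_isHomogeneous i g
  · intro h hh
    obtain ⟨g, hg, hh⟩ := Finset.mem_biUnion.mp hh
    obtain ⟨i, -, rfl⟩ := Finset.mem_image.mp hh
    exact hG g (hs hg).2 i
  · intro h hh
    obtain ⟨g, hg, hh⟩ := Finset.mem_biUnion.mp hh
    obtain ⟨i, -, rfl⟩ := Finset.mem_image.mp hh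
    exact hI g (hs hg).1 i
  · rw [← hspanI, Ideal.span_le]
    intro g hg
    rw [SetLike.mem_coe, ← sum_homogeneousComponent g]
    refine Ideal.sum_mem _ fun i hi => Ideal.subset_span ?_
    exact Finset.mem_biUnion.mpr ⟨g, hg, Finset.mem_image.mpr ⟨i, hi, rfl⟩⟩

/-- **Degree-sorted homogeneous generators inside `G`** (sort the finite set of
`exists_finset_homogeneous_subset_span_eq` by degree). [cite: CossartJannsenSaito2020, Rem. 2.5] -/
theorem exists_sorted_generators_forall_mem
    (hG : ∀ g ∈ G, ∀ d : ℕ, homogeneousComponent d g ∈ G) (hI : IsHomogeneousIdeal I)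
    (hIG : I ≤ Ideal.span ((I : Set (MvPolynomial (Fin n) K)) ∩ G)) :
    ∃ (m : ℕ) (φ : Fin m → MvPolynomial (Fin n) K) (deg : Fin m → ℕ),
      IsSortedGenerators I φ deg ∧ ∀ j, φ j ∈ G := by
  classical
  obtain ⟨s, hs, hsG, hsI⟩ := exists_finset_homogeneous_subset_span_eq hG hI hIG
  let r : MvPolynomial (Fin n) K → MvPolynomial (Fin n) K → Prop :=
    fun a b => a.totalDegree ≤ b.totalDegree
  haveI : Std.Total r := ⟨fun a b => le_total _ _⟩
  haveI : IsTrans _ r := ⟨fun a b c hab hbc => le_trans hab hbc⟩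
  let l : List (MvPolynomial (Fin n) K) := s.toList.insertionSort r
  have hperm : l.Perm s.toList := List.perm_insertionSort r _
  have hsorted : l.Pairwise r := List.pairwise_insertionSort r _
  have hmem : ∀ i : Fin l.length, l.get i ∈ s := fun i => by
    rw [← Finset.mem_toList, ← hperm.mem_iff]
    exact List.get_mem l i
  refine ⟨l.length, fun i => l.get i, fun i => (l.get i).totalDegree, ⟨fun i => hs _ (hmem i), ?_, ?_⟩,
    fun i => hsG (hmem i)⟩
  · rw [← hsI]
    congr 1
    ext g
    rw [Set.mem_range, Finset.mem_coe, ← Finset.mem_toList, ← hperm.mem_iff, List.mem_iff_get]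
  · intro i j hij
    rcases hij.lt_or_eq with hlt | heq
    · exact List.Pairwise.rel_get_of_lt hsorted hlt
    · rw [heq]

/-- **A degree-sorted family of homogeneous generators drawn from `G`, of minimal length among such
families, is weakly normalized**: a member lying in the ideal of its predecessors could be omitted,
and the shortened family is still drawn from `G`. [cite: CossartJannsenSaito2020, Rem. 2.5] -/
theorem isWeaklyNormalized_of_minimal_forall_mem {m : ℕ} {φ : Fin m → MvPolynomial (Fin n) K}
    {deg : Fin m → ℕ} (h : IsSortedGenerators I φ deg) (hφ : ∀ j, φ j ∈ G)
    (hmin : ∀ m' < m, ¬ ∃ (ψ : Fin m' → MvPolynomial (Fin n) K) (deg' : Fin m' → ℕ),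
      IsSortedGenerators I ψ deg' ∧ ∀ j, ψ j ∈ G) :
    IsWeaklyNormalized φ := by
  intro i hi
  cases m with
  | zero => exact i.elim0
  | succ m =>
    refine hmin m (Nat.lt_succ_self m) ⟨φ ∘ Fin.succAbove i, deg ∘ Fin.succAbove i,
      ⟨fun j => h.1 _, ?_, fun a b hab => h.2.2 ((Fin.strictMono_succAbove i).monotone hab)⟩,
      fun j => hφ _⟩
    rw [← h.2.1]
    refine le_antisymm (Ideal.span_mono (range_comp_succAbove_subset φ i)) (Ideal.span_le.mpr ?_)
    rintro _ ⟨j, rfl⟩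
    by_cases hji : j = i
    · subst hji
      refine Ideal.span_mono ?_ hi
      rintro _ ⟨l, hl, rfl⟩
      have hl' : l ≠ j := ne_of_lt hl
      obtain ⟨l', rfl⟩ := Fin.exists_succAbove_eq hl'
      exact ⟨l', rfl⟩
    · obtain ⟨j', rfl⟩ := Fin.exists_succAbove_eq hji
      exact Ideal.subset_span ⟨j', rfl⟩

/-- **A homogeneous ideal generated by elements of `G` (closed under homogeneous components) has a
standard base consisting of elements of `G`.** [cite: Hironaka1970NumericalCharacters, (14.3) p. 170]
[cite: CossartJannsenSaito2020, Cor. 2.4, Rem. 2.5] -/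
theorem exists_isStandardBase_forall_mem
    (hG : ∀ g ∈ G, ∀ d : ℕ, homogeneousComponent d g ∈ G) (hI : IsHomogeneousIdeal I)
    (hIG : I ≤ Ideal.span ((I : Set (MvPolynomial (Fin n) K)) ∩ G)) :
    ∃ (m : ℕ) (φ : Fin m → MvPolynomial (Fin n) K) (deg : Fin m → ℕ),
      IsStandardBase I φ deg ∧ ∀ j, φ j ∈ G := by
  classical
  let P : ℕ → Prop := fun m => ∃ (φ : Fin m → MvPolynomial (Fin n) K) (deg : Fin m → ℕ),
    IsSortedGenerators I φ deg ∧ ∀ j, φ j ∈ G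
  have hex : ∃ m, P m := by
    obtain ⟨m, φ, deg, h, hφ⟩ := exists_sorted_generators_forall_mem hG hI hIG
    exact ⟨m, φ, deg, h, hφ⟩
  obtain ⟨φ, deg, h, hφ⟩ := Nat.find_spec hex
  refine ⟨Nat.find hex, φ, deg, ⟨h.1, h.2.1, ?_, h.2.2⟩, hφ⟩
  exact isWeaklyNormalized_of_minimal_forall_mem h hφ fun m' hm' hP => Nat.find_min hex hm' hP

/-- **[H4] (14.3), algebraic core.** For `G ⊆ K[X]` closed under homogeneous components and a
homogeneous ideal `I`: `I` is generated by elements of `G` iff `I` has a standard base consisting of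
elements of `G`. [cite: Hironaka1970NumericalCharacters, (14.3) p. 170 L3–9] -/
theorem le_span_inter_iff_exists_isStandardBase
    (hG : ∀ g ∈ G, ∀ d : ℕ, homogeneousComponent d g ∈ G) (hI : IsHomogeneousIdeal I) :
    I ≤ Ideal.span ((I : Set (MvPolynomial (Fin n) K)) ∩ G) ↔
      ∃ (m : ℕ) (φ : Fin m → MvPolynomial (Fin n) K) (deg : Fin m → ℕ),
        IsStandardBase I φ deg ∧ ∀ j, φ j ∈ G :=
  ⟨exists_isStandardBase_forall_mem hG hI,
    fun ⟨_, _, _, h, hφ⟩ => le_span_inter_of_span_range_eq h.span_eq hφ⟩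

/-- The same over a GRADED SUBALGEBRA `U ⊆ K[X]`. [cite: Hironaka1970NumericalCharacters, (14.3) p. 170 L3–9] -/
theorem le_span_inter_iff_exists_isStandardBase_of_isGradedSubalgebra
    {U : Subalgebra K (MvPolynomial (Fin n) K)} (hU : IsGradedSubalgebra U) (hI : IsHomogeneousIdeal I) :
    I ≤ Ideal.span ((I : Set (MvPolynomial (Fin n) K)) ∩ (U : Set (MvPolynomial (Fin n) K))) ↔
      ∃ (m : ℕ) (φ : Fin m → MvPolynomial (Fin n) K) (deg : Fin m → ℕ),
        IsStandardBase I φ deg ∧ ∀ j, φ j ∈ U :=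
  le_span_inter_iff_exists_isStandardBase (G := (U : Set (MvPolynomial (Fin n) K)))
    (fun g hg d => hU g hg d) hI

/-- **[H4] (14.3) for the centre `D`, over Hironaka's `U(𝔭) = U_{g,x'}`** (`multAlgebra`, the graded
`K`-subalgebra of `K[X] = gr_x(Z,D)` of p. 168 L28–31): the homogeneous ideal `I` of the cone
`C_{X,D,x}` in `K[X]` is generated by elements of `U_{g,x'}` iff «there exists a standard base of the
ideal `I` consisting of elements in `U_{g,x'}`». Holds for every ideal `𝔭` (the source has `𝔭` the
homogeneous prime of the point `x'`). [cite: Hironaka1970NumericalCharacters, (14.3) p. 170 L3–9; (13.1) p. 168 L28–31] -/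
theorem le_span_inter_multAlgebra_iff_exists_isStandardBase (𝔭 : Ideal (MvPolynomial (Fin n) K))
    (hI : IsHomogeneousIdeal I) :
    I ≤ Ideal.span ((I : Set (MvPolynomial (Fin n) K)) ∩
        (multAlgebra K 𝔭 : Set (MvPolynomial (Fin n) K))) ↔
      ∃ (m : ℕ) (φ : Fin m → MvPolynomial (Fin n) K) (deg : Fin m → ℕ),
        IsStandardBase I φ deg ∧ ∀ j, φ j ∈ multAlgebra K 𝔭 :=
  le_span_inter_iff_exists_isStandardBase_of_isGradedSubalgebra (isGradedSubalgebra_multAlgebra 𝔭) hI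

end Within

/-! ## 2. CJS standard bases are Hironaka's standard bases of [H4] Remark 1 (minimal bases) -/

section Minimal

variable {K : Type u} [Field K] {n : ℕ} {I : Ideal (MvPolynomial (Fin n) K)} {m : ℕ}
  {φ : Fin m → MvPolynomial (Fin n) K} {deg : Fin m → ℕ}

/-- **A standard base is a MINIMAL base** ([H4] Rem. 1 (i)): no member lies in the ideal of the
OTHER members. (Graded Nakayama: from `φ_j = Σ_{l ≠ j} a_l φ_l`, the degree-`deg j` component gives
`Σ_{deg l = deg j} a_l(0) φ_l − φ_j ∈ 𝔪 I`, contradicting `IsStandardBase.eq_zero_of_sum_C_mul_mem`.)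
[cite: Hironaka1970NumericalCharacters, Remark 1 p. 155] [cite: CossartJannsenSaito2020, Lemma 2.2 (proof)] -/
theorem not_mem_span_image_ne_of_isStandardBase (h : IsStandardBase I φ deg) (j : Fin m) :
    φ j ∉ Ideal.span (φ '' {l | l ≠ j}) := by
  classical
  intro hj
  obtain ⟨c, hcsupp, hc⟩ := (Finsupp.mem_span_image_iff_linearCombination _).mp hj
  -- `a l = c l` for `l ≠ j`, `a j = -1`; then `Σ a_l φ_l = 0`
  have hcj : c j = 0 := by
    by_contra hne
    exact (hcsupp (Finsupp.mem_support_iff.mpr hne)) rfl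
  let a : Fin m → MvPolynomial (Fin n) K := fun l => c l - if l = j then 1 else 0
  have hsum : ∑ l, a l * φ l = 0 := by
    have hlc : ∑ l, c l * φ l = φ j := by
      rw [← hc, Finsupp.linearCombination_apply, Finsupp.sum_fintype]
      · simp only [smul_eq_mul]
      · exact fun l => zero_smul _ _
    simp only [a, sub_mul, Finset.sum_sub_distrib, hlc, ite_mul, one_mul, zero_mul,
      Finset.sum_ite_eq', Finset.mem_univ, if_true, sub_self]
  -- degree-`deg j` component: constants of the `a l` with `deg l = deg j`
  let e : Fin m → K := fun l => if deg l = deg j then constantCoeff (a l) else 0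
  have hker : ∀ l, deg l < deg j →
      homogeneousComponent (deg j - deg l) (a l) * φ l ∈
        RingHom.ker (constantCoeff : MvPolynomial (Fin n) K →+* K) * I := by
    intro l hl
    refine Ideal.mul_mem_mul ?_ (h.span_eq ▸ Ideal.subset_span ⟨l, rfl⟩)
    have hpos : 0 < deg j - deg l := Nat.sub_pos_of_lt hl
    rw [RingHom.mem_ker, constantCoeff_eq]
    exact (homogeneousComponent_isHomogeneous _ _).coeff_eq_zero
      (by rw [map_zero]; exact hpos.ne)
  have hcomp : ∀ l, homogeneousComponent (deg j) (a l * φ l) =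
      C (e l) * φ l + (if deg l < deg j then homogeneousComponent (deg j - deg l) (a l) * φ l else 0) := by
    intro l
    rcases lt_trichotomy (deg l) (deg j) with hlt | heq | hgt
    · have hne : deg l ≠ deg j := hlt.ne
      obtain ⟨t, ht⟩ := Nat.exists_eq_add_of_lt hlt
      simp only [e, if_neg hne, if_pos hlt, C_0, zero_mul, zero_add]
      rw [show deg j = (t + 1) + deg l by omega, mul_comm (a l),
        homogeneousComponent_mul_add_of_isHomogeneous (h.isHomogeneous l), mul_comm,
        show t + 1 + deg l - deg l = t + 1 by omega]
    · simp only [e, if_pos heq, lt_irrefl, heq, if_false, add_zero]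
      rw [show deg j = 0 + deg j from (Nat.zero_add _).symm, ← heq, mul_comm (a l),
        homogeneousComponent_mul_add_of_isHomogeneous (h.isHomogeneous l), homogeneousComponent_zero,
        mul_comm, constantCoeff_eq]
    · have hne : deg l ≠ deg j := hgt.ne'
      simp only [e, if_neg hne, if_neg (not_lt.mpr hgt.le), C_0, zero_mul, add_zero]
      rw [mul_comm]
      exact homogeneousComponent_mul_eq_zero_of_lt (h.isHomogeneous l) hgt
  have hmem : ∑ l, C (e l) * φ l ∈
      RingHom.ker (constantCoeff : MvPolynomial (Fin n) K →+* K) * I := by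
    have h0 : homogeneousComponent (deg j) (∑ l, a l * φ l) = 0 := by rw [hsum, map_zero]
    rw [map_sum, Finset.sum_congr rfl fun l _ => hcomp l, Finset.sum_add_distrib] at h0
    have : ∑ l, C (e l) * φ l =
        -∑ l, (if deg l < deg j then homogeneousComponent (deg j - deg l) (a l) * φ l else 0) :=
      eq_neg_of_add_eq_zero_left h0
    rw [this]
    refine neg_mem (Ideal.sum_mem _ fun l _ => ?_)
    split_ifs with hl
    · exact hker l hl
    · exact zero_mem _
  have he := congr_fun (h.eq_zero_of_sum_C_mul_mem hmem) j
  simp only [e, if_true, a, if_true, hcj, zero_sub, map_neg, map_one, Pi.zero_apply,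
    neg_eq_zero, one_ne_zero] at he

/-- **[H4] Remark 1 ⟺ CJS Def. 2.3.** A family `φ` with degrees `deg` is a standard base of `I` iff
its members are homogeneous of the given non-decreasing degrees, generate `I`, and form a MINIMAL
base (no member in the ideal of the others). [cite: Hironaka1970NumericalCharacters, Remark 1 p. 155]
[cite: CossartJannsenSaito2020, Def. 2.3] -/
theorem isStandardBase_iff_minimal :
    IsStandardBase I φ deg ↔
      (∀ j, (φ j).IsHomogeneous (deg j)) ∧ Ideal.span (Set.range φ) = I ∧ Monotone deg ∧
        ∀ j, φ j ∉ Ideal.span (φ '' {l | l ≠ j}) := by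
  constructor
  · exact fun h => ⟨h.isHomogeneous, h.span_eq, h.monotone, not_mem_span_image_ne_of_isStandardBase h⟩
  · rintro ⟨hhom, hspan, hmono, hmin⟩
    refine ⟨hhom, hspan, fun j hj => hmin j (Ideal.span_mono ?_ hj), hmono⟩
    rintro _ ⟨l, hl, rfl⟩
    exact ⟨l, ne_of_lt hl, rfl⟩

end Minimal

/-! ## 3. Generation by elements of `U` is insensitive to adjoining variables (p. 170 L5–9) -/

section Retract

variable {A : Type u} {B : Type v} [CommRing A] [CommRing B] {F : Type*} {E : Type*}
  [FunLike F A B] [RingHomClass F A B] [FunLike E B A] [RingHomClass E B A]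

/-- Along a ring map `f` with a retraction `r` (`r ∘ f = id`), extension–contraction is the identity:
`f⁻¹(J·B) = J` (the algebra behind p. 170 L5–9: an ideal of `gr_x(Z,D) = K[X]` is recovered from its
extension to `gr_x(Z) = K[X,Y]`). [cite: Hironaka1970NumericalCharacters, p. 170 L5–9] -/
theorem comap_map_eq_of_leftInverse (f : F) (r : E) (hrf : ∀ a, r (f a) = a)
    (J : Ideal A) : (J.map f).comap f = J := by
  refine le_antisymm (fun a ha => ?_) Ideal.le_comap_map
  have h1 : (J.map f).map r ≤ J := by
    rw [Ideal.map_le_iff_le_comap, Ideal.map_le_iff_le_comap]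
    intro x hx
    rw [Ideal.mem_comap, Ideal.mem_comap, hrf]
    exact hx
  have := Ideal.mem_map_of_mem r (Ideal.mem_comap.mp ha)
  rw [hrf] at this
  exact h1 this

/-- **The normal-flatness clause of (14.3) as algebra.** Along a ring map `f : A → B` with a retraction
(e.g. `K[X] ⊆ K[X,Y]`), for an ideal `J ⊆ A` and a set `G ⊆ A`: the extended ideal `J·B` is generated
by elements of `f(G)` iff `J` is generated by elements of `G`. (p. 170 L5–9: «the ideal of `C_{X,x}` in
`gr_x(Z)` is generated by the ideal of `C_{X,D,x}` in `gr_x(Z,D) = K[X]`», so generation by elements of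
`U_{g,x'} ⊆ K[X]` can be tested in `K[X]`.) [cite: Hironaka1970NumericalCharacters, p. 170 L5–9] -/
theorem map_le_span_inter_image_iff (f : F) (r : E) (hrf : ∀ a, r (f a) = a)
    (J : Ideal A) (G : Set A) :
    J.map f ≤ Ideal.span ((J.map f : Set B) ∩ f '' G) ↔ J ≤ Ideal.span ((J : Set A) ∩ G) := by
  constructor
  · intro h
    have key : Ideal.span ((J.map f : Set B) ∩ f '' G) ≤ (Ideal.span ((J : Set A) ∩ G)).map f := by
      rw [Ideal.span_le]
      rintro _ ⟨hb, g, hg, rfl⟩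
      have hgJ : g ∈ J := by
        rw [← comap_map_eq_of_leftInverse f r hrf J]
        exact Ideal.mem_comap.mpr hb
      exact Ideal.mem_map_of_mem f (Ideal.subset_span ⟨hgJ, hg⟩)
    calc J = (J.map f).comap f := (comap_map_eq_of_leftInverse f r hrf J).symm
      _ ≤ ((Ideal.span ((J : Set A) ∩ G)).map f).comap f := Ideal.comap_mono (h.trans key)
      _ = Ideal.span ((J : Set A) ∩ G) := comap_map_eq_of_leftInverse f r hrf _
  · intro h
    refine (Ideal.map_mono h).trans ?_
    rw [Ideal.map_span, Ideal.span_le]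
    rintro _ ⟨g, ⟨hgJ, hgG⟩, rfl⟩
    exact Ideal.subset_span ⟨Ideal.mem_map_of_mem f hgJ, g, hgG, rfl⟩

end Retract

section Rename

variable {K : Type u} [Field K] {σ : Type v} {τ : Type w}

/-- **Adjoining variables** (`K[X] ⊆ K[X,Y]` as `rename` along an injective map of variables, with
retraction `killCompl`): an ideal `J ⊆ K[X]` extended to `K[X,Y]` is generated by elements of (the
image of) `G ⊆ K[X]` iff `J` is generated by elements of `G`. [cite: Hironaka1970NumericalCharacters, p. 170 L5–9] -/
theorem map_rename_le_span_inter_image_iff {f : σ → τ} (hf : Function.Injective f)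
    (J : Ideal (MvPolynomial σ K)) (G : Set (MvPolynomial σ K)) :
    J.map (rename f) ≤ Ideal.span ((J.map (rename f) : Set (MvPolynomial τ K)) ∩ rename f '' G) ↔
      J ≤ Ideal.span ((J : Set (MvPolynomial σ K)) ∩ G) :=
  map_le_span_inter_image_iff (rename f) (killCompl hf) (killCompl_rename_app hf) J G

end Rename

/-! ## 4. (14.3) assembled in the shapes of the cell's typed facts -/

section Assembly

variable {K : Type u} [Field K] {n : ℕ}

/-- **[H4] (14.3), `gr_x(Z)`-form.** With `gr_x(Z,D) = K[X] ⊆ K[X,Y] = gr_x(Z)` (`rename` along an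
injective map of variables) and the homogeneous ideal `I ⊆ K[X]` of `C_{X,D,x}`: the ideal `I·gr_x(Z)`
(= the ideal of `C_{X,x}` under normal flatness, p. 170 L5–7) is generated by elements of `U_{g,x'}`
— i.e. «`C_{X,x}` is invariant by `B_{g,x'}`» by the definition p. 170 L3–4 — iff `I` has a standard
base consisting of elements of `U_{g,x'} = multAlgebra K 𝔭`. [cite: Hironaka1970NumericalCharacters, (14.3) p. 170 L3–9] -/
theorem map_rename_le_span_inter_multAlgebra_iff {τ : Type w} {f : Fin n → τ}
    (hf : Function.Injective f) (𝔭 : Ideal (MvPolynomial (Fin n) K))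
    {I : Ideal (MvPolynomial (Fin n) K)} (hI : IsHomogeneousIdeal I) :
    I.map (rename f) ≤ Ideal.span ((I.map (rename f) : Set (MvPolynomial τ K)) ∩
        rename f '' (multAlgebra K 𝔭 : Set (MvPolynomial (Fin n) K))) ↔
      ∃ (m : ℕ) (φ : Fin m → MvPolynomial (Fin n) K) (deg : Fin m → ℕ),
        IsStandardBase I φ deg ∧ ∀ j, φ j ∈ multAlgebra K 𝔭 := by
  rw [map_rename_le_span_inter_image_iff hf]
  exact le_span_inter_multAlgebra_iff_exists_isStandardBase 𝔭 hI

variable {A : Type u} [CommRing A] [IsLocalRing A]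

/-- **(14.3), point-centre shape** — the conclusion of the cell's typed `Hironaka1970_thmIV_point`
(`Hironaka1970NearPointInvariantCone.lean`): the tangent-cone ideal `J = In_𝔪(A) ⊆ k[X_1, …, X_e]`
(w.r.t. generators `x` of `𝔪`) is generated by its elements in `U(𝔭)` iff `J` has a standard base
consisting of elements of `U(𝔭)`. [cite: Hironaka1970NumericalCharacters, (14.3) p. 170 L3–9] -/
theorem tangentConeIdeal_le_span_inter_multAlgebra_iff {e : ℕ} (x : Fin e → A)
    (hx : Ideal.span (Set.range x) = IsLocalRing.maximalIdeal A)
    (𝔭 : Ideal (MvPolynomial (Fin e) (IsLocalRing.ResidueField A))) :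
    tangentConeIdeal x hx ≤ Ideal.span
        ((tangentConeIdeal x hx : Set (MvPolynomial (Fin e) (IsLocalRing.ResidueField A))) ∩
          (multAlgebra (IsLocalRing.ResidueField A) 𝔭 :
            Set (MvPolynomial (Fin e) (IsLocalRing.ResidueField A)))) ↔
      ∃ (m : ℕ) (φ : Fin m → MvPolynomial (Fin e) (IsLocalRing.ResidueField A)) (deg : Fin m → ℕ),
        IsStandardBase (tangentConeIdeal x hx) φ deg ∧
          ∀ j, φ j ∈ multAlgebra (IsLocalRing.ResidueField A) 𝔭 :=
  le_span_inter_multAlgebra_iff_exists_isStandardBase 𝔭 (isHomogeneousIdeal_tangentConeIdeal x hx)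

/-- **(14.3), arbitrary-centre shape** — the conclusion of the cell's typed `Hironaka1970_thmIV`
(`Hironaka1970NearPointNormalCone.lean`): the normal-cone ideal `I ⊆ k[X_1, …, X_m]` of
`C_{X,D,x} ⊂ N_{Z,D,x}` (w.r.t. generators `g` of the ideal of `D`) is generated by its elements in
`U(𝔭)` iff `I` has a standard base consisting of elements of `U(𝔭)`. [cite: Hironaka1970NumericalCharacters, (14.3) p. 170 L3–9] -/
theorem normalConeIdeal_le_span_inter_multAlgebra_iff {m : ℕ} (g : Fin m → A)
    (𝔭 : Ideal (MvPolynomial (Fin m) (IsLocalRing.ResidueField A))) :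
    normalConeIdeal g ≤ Ideal.span
        ((normalConeIdeal g : Set (MvPolynomial (Fin m) (IsLocalRing.ResidueField A))) ∩
          (multAlgebra (IsLocalRing.ResidueField A) 𝔭 :
            Set (MvPolynomial (Fin m) (IsLocalRing.ResidueField A)))) ↔
      ∃ (k : ℕ) (φ : Fin k → MvPolynomial (Fin m) (IsLocalRing.ResidueField A)) (deg : Fin k → ℕ),
        IsStandardBase (normalConeIdeal g) φ deg ∧
          ∀ j, φ j ∈ multAlgebra (IsLocalRing.ResidueField A) 𝔭 :=
  le_span_inter_multAlgebra_iff_exists_isStandardBase 𝔭 (isHomogeneousIdeal_normalConeIdeal g)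

end Assembly

end Literature.AlgebraicGeometry.Resolution.HironakaScheme

end
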